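import Literature.MathematicalPhysics.QuantumLattice.MatsubaraTruncationMidpoint
import Literature.Analysis.Fourier.AbsSinFourierSeries
import Mathlib.Analysis.Fourier.AddCircle
import HarnessLib

/-!
# The truncated Matsubara representation of the free propagator, I: the continuous remainder

Topic `Literature/MathematicalPhysics/QuantumLattice`; first half of the `M → ∞` ("Matsubara UV") limit of
the truncated fermionic frequency sums of the tree (`MatsubaraIdx M = Fin (2M)`, `ωᵢ = π(2n+1)/β`,
`n ∈ [-M, M)`, `HubbardFreeCovariance.lean`), complementing the equal-time statement
`MatsubaraTruncationMidpoint.tendsto_truncatedTadpole`.  The propagator `1/(iω − ξ)` is split as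

  `1/(iω − ξ) = 1/(iω) + (1/(iω − ξ) − 1/(iω))`,

the first part carrying the jump of the time-ordered propagator (a square wave, treated in part II with
`Literature.Analysis.Fourier.SquareWaveSineSeries`), the second being `O(ω⁻²)`: its Fourier series converges
absolutely and uniformly.  This file identifies the limit of the second part,

  `R_M(τ) = (1/β) Σᵢ e^{-iωᵢτ} (1/(iωᵢ − ξ) − 1/(iωᵢ))`,

for `τ ∈ [-β, β]`:

* `tendsto_truncatedRemainder_of_mem_Icc` — for `τ ∈ [0, β]`,
  `R_M(τ) → ½ − e^{-ξτ}/(1 + e^{-βξ}) = ½ − (1 − n_F(ξ)) e^{-ξτ}`;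
* `tendsto_truncatedRemainder_of_mem_Icc_neg` — for `τ ∈ [-β, 0]`,
  `R_M(τ) → e^{-ξτ}/(1 + e^{βξ}) − ½ = n_F(ξ) e^{-ξτ} − ½`;
* `norm_truncatedRemainder_le` — the uniform bound `‖R_M(τ)‖ ≤ β|ξ|/3` (all `M`, all real `τ`).

Method: `G(τ) = e^{iπτ/β}(½ − (1 − n_F)e^{-ξτ})` is continuous and `β`-PERIODIC (the phase turns the
`β`-antiperiodic remainder into a periodic function), its Fourier coefficients on `AddCircle β` are
`d_n = (1/β)(1/(iνₙ) − 1/(iνₙ + ξ))`, `νₙ = π(2n−1)/β` (`integral_remainderFn_fourier`), they are summable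
(`O(n⁻²)`), so Mathlib's `has_pointwise_sum_fourier_series_of_summable` gives pointwise convergence of the
symmetric partial sums, which are exactly `e^{iπτ/β} R_M(τ)` after the re-indexing `n = -m`
(`sum_matsubaraIdx_freq_eq_sum_Ioc`).  Everything is proved; no definitions, no named facts.

## Sources

G. Benfatto, A. Giuliani, V. Mastropietro, Ann. Henri Poincaré 7 (2006) 809–898, §2.1 (2.3)–(2.4) (the
propagator as the `M → ∞` limit of the truncated frequency sum) [`BenfattoGiulianiMastropietro2006`];
A. Giuliani, V. Mastropietro, Commun. Math. Phys. 293 (2010) 301–346, App. A (A.19)–(A.21)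
[`GiulianiMastropietro2010`]; A. L. Fetter, J. D. Walecka, *Quantum Theory of Many-Particle Systems* (1971),
§25. [folklore]
-/

noncomputable section

namespace Literature.MathematicalPhysics.QuantumLattice

open Finset Filter Complex MeasureTheory _root_.Topology
open scoped Real

/-! ### Re-indexing the symmetric frequency set -/

/-- **One-sided form**: a sum over the `2M` frequencies `ωᵢ`, `n = i − M ∈ [-M, M)`, is the sum over the
`M` positive frequencies `(2n+1)π/β` plus the sum over their negatives. [folklore] -/
theorem sum_matsubaraIdx_freq_eq_sum_range {α : Type*} [AddCommMonoid α] (β : ℝ) (M : ℕ) (f : ℝ → α) :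
    ∑ i : MatsubaraIdx M, f (matsubaraFreq β M i) =
      ∑ n ∈ range M, f ((2 * n + 1) * π / β) + ∑ n ∈ range M, f (-((2 * n + 1) * π / β)) := by
  set g : ℕ → α := fun j => f (π * (2 * ((j : ℝ) - M) + 1) / β) with hg
  have key : ∀ i : MatsubaraIdx M, f (matsubaraFreq β M i) = g (i : ℕ) := by
    intro i
    simp only [hg, matsubaraFreq, matsubaraInt]
    push_cast
    ring_nf
  have hsum : ∑ i : MatsubaraIdx M, f (matsubaraFreq β M i) = ∑ j ∈ range (2 * M), g j := by
    rw [← Fin.sum_univ_eq_sum_range]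
    exact Finset.sum_congr rfl fun i _ => key i
  rw [hsum, two_mul M, Finset.sum_range_add, add_comm]
  congr 1
  · refine Finset.sum_congr rfl fun j _ => ?_
    simp only [hg]
    congr 1
    push_cast
    ring
  · rw [← Finset.sum_range_reflect g M]
    refine Finset.sum_congr rfl fun m hm => ?_
    have hm' : m < M := Finset.mem_range.1 hm
    have hcast : ((M - 1 - m : ℕ) : ℝ) = (M : ℝ) - 1 - m := by
      rw [Nat.sub_sub, Nat.cast_sub (by omega)]
      push_cast
      ring
    simp only [hg, hcast]
    congr 1
    ring

/-- **Symmetric form**: with `n = M − i ∈ (-M, M]` the frequencies are `ωᵢ = π(1 − 2n)/β`, so a sum over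
`MatsubaraIdx M` is a sum over the integer interval `(-M, M]`. [folklore] -/
theorem sum_matsubaraIdx_freq_eq_sum_Ioc {α : Type*} [AddCommMonoid α] (β : ℝ) (M : ℕ) (f : ℝ → α) :
    ∑ i : MatsubaraIdx M, f (matsubaraFreq β M i) =
      ∑ n ∈ Finset.Ioc (-(M : ℤ)) M, f (π * (1 - 2 * (n : ℝ)) / β) := by
  have himage : Finset.Ioc (-(M : ℤ)) M = (range (2 * M)).image fun j : ℕ => (M : ℤ) - j := by
    ext n
    simp only [Finset.mem_Ioc, Finset.mem_image, Finset.mem_range]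
    constructor
    · rintro ⟨h1, h2⟩
      refine ⟨((M : ℤ) - n).toNat, ?_, ?_⟩ <;> omega
    · rintro ⟨j, hj, rfl⟩
      omega
  have hinj : Set.InjOn (fun j : ℕ => (M : ℤ) - j) (range (2 * M) : Finset ℕ) := by
    intro a _ b _ h
    have : (a : ℤ) = b := by linarith
    exact_mod_cast this
  rw [himage, Finset.sum_image hinj, ← Fin.sum_univ_eq_sum_range]
  refine Finset.sum_congr rfl fun i _ => ?_
  simp only [matsubaraFreq, matsubaraInt]
  push_cast
  ring_nf

/-! ### The periodic remainder function and its Fourier coefficients -/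

/-- `e^{iπ(1 − 2n)} = -1` for an integer `n`. [folklore] -/
theorem exp_I_pi_one_sub_two_mul (n : ℤ) : cexp (I * π * (1 - 2 * (n : ℂ))) = -1 := by
  have h := Literature.Analysis.Fourier.exp_pi_mul_I_mul_odd (-n)
  rw [← h]
  congr 1
  push_cast
  ring

/-- The odd frequency `ν = π(2n − 1)/β` does not vanish (`β ≠ 0`). [folklore] -/
theorem pi_mul_two_mul_sub_one_div_ne_zero {β : ℝ} (hβ : β ≠ 0) (n : ℤ) :
    π * (2 * (n : ℝ) - 1) / β ≠ 0 := by
  refine div_ne_zero (mul_ne_zero Real.pi_ne_zero ?_) hβ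
  have h : (2 * n - 1 : ℤ) ≠ 0 := by omega
  exact_mod_cast h

/-- `iν + ξ ≠ 0` for real `ν ≠ 0`, `ξ`. [folklore] -/
theorem I_mul_add_ofReal_ne_zero {ν : ℝ} (hν : ν ≠ 0) (ξ : ℝ) : I * (ν : ℂ) + ξ ≠ 0 := by
  intro h
  have := congrArg Complex.im h
  simp at this
  exact hν this

/-- `iν − ξ ≠ 0` for real `ν ≠ 0`, `ξ`. [folklore] -/
theorem I_mul_sub_ofReal_ne_zero {ν : ℝ} (hν : ν ≠ 0) (ξ : ℝ) : I * (ν : ℂ) - ξ ≠ 0 := by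
  intro h
  have := congrArg Complex.im h
  simp at this
  exact hν this

/-- **The Fourier coefficient integral of the remainder**: with `A = (1 + e^{-βξ})⁻¹` and `ν = π(2n−1)/β`,
`(1/β) ∫₀^β e^{-2πint/β} e^{iπt/β} (½ − A e^{-ξt}) dt = (1/β)(1/(iν) − 1/(iν + ξ))` (`β > 0`). [folklore] -/
theorem integral_remainderFn_fourier {β : ℝ} (hβ : 0 < β) (ξ : ℝ) (n : ℤ) :
    (1 / (β : ℂ)) * ∫ t in (0 : ℝ)..β, cexp (2 * π * I * (-n) * t / β) *
        (cexp (I * π * t / β) * (1 / 2 - (1 + Real.exp (-(β * ξ)))⁻¹ * Real.exp (-(ξ * t)))) =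
      (1 / (β : ℂ)) * (1 / (I * (π * (2 * (n : ℝ) - 1) / β : ℝ)) -
        1 / (I * (π * (2 * (n : ℝ) - 1) / β : ℝ) + ξ)) := by
  have hβ0 : (β : ℂ) ≠ 0 := by exact_mod_cast hβ.ne'
  set ν : ℝ := π * (2 * (n : ℝ) - 1) / β with hν
  have hν0 : ν ≠ 0 := pi_mul_two_mul_sub_one_div_ne_zero hβ.ne' n
  set A : ℝ := (1 + Real.exp (-(β * ξ)))⁻¹ with hA
  set c₁ : ℂ := -(I * ν) with hc₁
  set c₂ : ℂ := -(I * ν) - ξ with hc₂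
  have hc₁0 : c₁ ≠ 0 := by
    rw [hc₁, neg_ne_zero]; exact mul_ne_zero I_ne_zero (by exact_mod_cast hν0)
  have hc₂0 : c₂ ≠ 0 := by
    rw [hc₂, show -(I * (ν : ℂ)) - ξ = -(I * ν + ξ) by ring, neg_ne_zero]
    exact I_mul_add_ofReal_ne_zero hν0 ξ
  -- the integrand is a combination of two exponentials
  have hpt : ∀ t : ℝ, cexp (2 * π * I * (-n) * t / β) *
      (cexp (I * π * t / β) * (1 / 2 - (A : ℝ) * Real.exp (-(ξ * t)))) =
      (1 / 2) * cexp (c₁ * t) - (A : ℂ) * cexp (c₂ * t) := by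
    intro t
    have e1 : cexp (2 * π * I * (-n) * t / β) * cexp (I * π * t / β) = cexp (c₁ * t) := by
      rw [← Complex.exp_add, hc₁, hν]
      congr 1
      push_cast
      field_simp
      ring
    have e2 : cexp (c₁ * t) * (Real.exp (-(ξ * t)) : ℂ) = cexp (c₂ * t) := by
      rw [Complex.ofReal_exp, ← Complex.exp_add, hc₂]
      congr 1
      push_cast
      ring
    calc cexp (2 * π * I * (-n) * t / β) * (cexp (I * π * t / β) * (1 / 2 - (A : ℝ) * Real.exp (-(ξ * t))))
        = (cexp (2 * π * I * (-n) * t / β) * cexp (I * π * t / β)) * (1 / 2) -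
            (A : ℂ) * ((cexp (2 * π * I * (-n) * t / β) * cexp (I * π * t / β)) * Real.exp (-(ξ * t))) := by
          ring
      _ = (1 / 2) * cexp (c₁ * t) - (A : ℂ) * cexp (c₂ * t) := by rw [e1, e2]; ring
  have hint : ∫ t in (0 : ℝ)..β, cexp (2 * π * I * (-n) * t / β) *
      (cexp (I * π * t / β) * (1 / 2 - (A : ℝ) * Real.exp (-(ξ * t)))) =
      (1 / 2) * ((cexp (c₁ * β) - cexp (c₁ * ((0 : ℝ) : ℂ))) / c₁) -
        (A : ℂ) * ((cexp (c₂ * β) - cexp (c₂ * ((0 : ℝ) : ℂ))) / c₂) := by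
    rw [intervalIntegral.integral_congr (fun t _ => hpt t), intervalIntegral.integral_sub,
      intervalIntegral.integral_const_mul, intervalIntegral.integral_const_mul,
      integral_exp_mul_complex hc₁0, integral_exp_mul_complex hc₂0]
    · apply Continuous.intervalIntegrable; fun_prop
    · apply Continuous.intervalIntegrable; fun_prop
  -- boundary values: `e^{c₁β} = e^{iπ(1-2n)} = -1`, `e^{c₂β} = -e^{-βξ}`
  have hb1 : cexp (c₁ * β) = -1 := by
    rw [← exp_I_pi_one_sub_two_mul n, hc₁, hν]
    congr 1
    push_cast
    field_simp
    ring
  have hb2 : cexp (c₂ * β) = -(Real.exp (-(β * ξ)) : ℂ) := by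
    rw [hc₂, sub_mul, Complex.exp_sub, ← hc₁, hb1, Complex.ofReal_exp]
    rw [div_eq_mul_inv, ← Complex.exp_neg]
    push_cast
    ring_nf
  have hA1 : (A : ℂ) * (1 + Real.exp (-(β * ξ))) = 1 := by
    rw [hA]
    have : (1 + Real.exp (-(β * ξ))) ≠ 0 := by positivity
    push_cast
    rw [inv_mul_cancel₀]
    exact_mod_cast this
  rw [hint, hb1, hb2, Complex.ofReal_zero, mul_zero, mul_zero, Complex.exp_zero]
  congr 1
  have hIν : I * (ν : ℂ) ≠ 0 := mul_ne_zero I_ne_zero (by exact_mod_cast hν0)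
  have hIνξ : I * (ν : ℂ) + ξ ≠ 0 := I_mul_add_ofReal_ne_zero hν0 ξ
  have h1 : (1 / 2 : ℂ) * ((-1 - 1) / c₁) = 1 / (I * ν) := by
    rw [hc₁]
    field_simp
    ring
  have h2 : (A : ℂ) * ((-(Real.exp (-(β * ξ)) : ℂ) - 1) / c₂) = 1 / (I * ν + ξ) := by
    rw [hc₂, show (-(Real.exp (-(β * ξ)) : ℂ) - 1) = -(1 + Real.exp (-(β * ξ))) by ring,
      show -(I * (ν : ℂ)) - ξ = -(I * ν + ξ) by ring, neg_div_neg_eq, ← mul_div_assoc, hA1]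
  rw [h1, h2]

/-- **Norm of the remainder coefficient**: `‖1/(iν) − 1/(iν + ξ)‖ ≤ |ξ|/ν²` (`ν ≠ 0`), since
`|iν + ξ| ≥ |ν|`. [folklore] -/
theorem norm_inv_I_mul_sub_inv_le {ν : ℝ} (hν : ν ≠ 0) (ξ : ℝ) :
    ‖1 / (I * (ν : ℂ)) - 1 / (I * ν + ξ)‖ ≤ |ξ| / ν ^ 2 := by
  have hIν : I * (ν : ℂ) ≠ 0 := mul_ne_zero I_ne_zero (by exact_mod_cast hν)
  have hIνξ : I * (ν : ℂ) + ξ ≠ 0 := I_mul_add_ofReal_ne_zero hν ξ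
  have heq : 1 / (I * (ν : ℂ)) - 1 / (I * ν + ξ) = ξ / ((I * ν) * (I * ν + ξ)) := by
    rw [div_sub_div _ _ hIν hIνξ, one_mul, mul_one]
    congr 1
    ring
  rw [heq, norm_div, norm_mul, Complex.norm_real, Real.norm_eq_abs]
  have h1 : ‖I * (ν : ℂ)‖ = |ν| := by rw [norm_mul, norm_I, one_mul, Complex.norm_real, Real.norm_eq_abs]
  have h2 : |ν| ≤ ‖I * (ν : ℂ) + ξ‖ := by
    have h := Complex.abs_im_le_norm (I * (ν : ℂ) + ξ)
    simpa using h
  rw [h1]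
  have hνpos : 0 < |ν| := abs_pos.2 hν
  calc |ξ| / (|ν| * ‖I * (ν : ℂ) + ξ‖) ≤ |ξ| / (|ν| * |ν|) := by
        gcongr
    _ = |ξ| / ν ^ 2 := by rw [← sq, sq_abs]

/-! ### The Fourier series of the remainder on `AddCircle β` -/

section Fourier

variable {β : ℝ} (hβ : 0 < β) (ξ : ℝ)

/-- The remainder coefficients are summable: `‖d_n‖ ≤ |ξ|β/(π²(2n−1)²)`. [folklore] -/
theorem summable_remainderCoeff {β : ℝ} (hβ : 0 < β) (ξ : ℝ) :
    Summable fun n : ℤ => (1 / (β : ℂ)) * (1 / (I * (π * (2 * (n : ℝ) - 1) / β : ℝ)) -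
      1 / (I * (π * (2 * (n : ℝ) - 1) / β : ℝ) + ξ)) := by
  have hb : ∀ n : ℤ, ‖(1 / (β : ℂ)) * (1 / (I * (π * (2 * (n : ℝ) - 1) / β : ℝ)) -
      1 / (I * (π * (2 * (n : ℝ) - 1) / β : ℝ) + ξ))‖ ≤ |ξ| * β / π ^ 2 * (1 / (2 * (n : ℝ) - 1) ^ 2) := by
    intro n
    have hν := pi_mul_two_mul_sub_one_div_ne_zero hβ.ne' n
    rw [norm_mul, norm_div, norm_one, Complex.norm_real, Real.norm_of_nonneg hβ.le]
    refine (mul_le_mul_of_nonneg_left (norm_inv_I_mul_sub_inv_le hν ξ) (by positivity)).trans (le_of_eq ?_)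
    have h2 : (2 * (n : ℝ) - 1) ≠ 0 := by
      have h : (2 * n - 1 : ℤ) ≠ 0 := by omega
      exact_mod_cast h
    field_simp
  refine Summable.of_norm_bounded_eventually
    (((Real.summable_one_div_int_pow.mpr one_lt_two).mul_left (|ξ| * β / π ^ 2 * 4))) ?_
  filter_upwards [eventually_cofinite_ne (0 : ℤ)] with n hn
  refine (hb n).trans ?_
  rw [mul_assoc]
  refine mul_le_mul_of_nonneg_left ?_ (by positivity)
  -- `1/(2n-1)² ≤ 4/n²` for `n ≠ 0`
  have hn' : (n : ℝ) ≠ 0 := by exact_mod_cast hn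
  have h1 : |(n : ℝ)| ≤ |2 * (n : ℝ) - 1| := by
    rcases le_or_gt 1 n with h | h
    · have : (1 : ℝ) ≤ n := by exact_mod_cast h
      rw [abs_of_pos (by linarith), abs_of_pos (by linarith)]; linarith
    · have : n ≤ 0 := by omega
      have : (n : ℝ) ≤ 0 := by exact_mod_cast this
      rw [abs_of_nonpos this, abs_of_nonpos (by linarith)]; linarith
  have h3 : (n : ℝ) ^ 2 ≤ (2 * (n : ℝ) - 1) ^ 2 := by
    rw [← sq_abs, ← sq_abs (2 * (n : ℝ) - 1)]
    exact pow_le_pow_left₀ (abs_nonneg _) h1 2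
  have hpos : 0 < (n : ℝ) ^ 2 := by positivity
  rw [div_le_iff₀ (lt_of_lt_of_le hpos h3)]
  calc (1 : ℝ) = 4 * (1 / (n : ℝ) ^ 2) * ((n : ℝ) ^ 2 / 4) := by field_simp
    _ ≤ 4 * (1 / (n : ℝ) ^ 2) * (2 * (n : ℝ) - 1) ^ 2 := by gcongr; linarith

/-- **Pointwise Fourier expansion of the periodic remainder function** `G(τ) = e^{iπτ/β}(½ − A e^{-ξτ})`,
`A = (1 + e^{-βξ})⁻¹`, on `[0, β]`: `G(τ) = Σ_n d_n e^{2πinτ/β}` with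
`d_n = (1/β)(1/(iνₙ) − 1/(iνₙ + ξ))`, `νₙ = π(2n−1)/β` (Mathlib's
`has_pointwise_sum_fourier_series_of_summable` on `AddCircle β`, unwrapped). [folklore] -/
theorem hasSum_remainderFn_fourier {β : ℝ} (hβ : 0 < β) (ξ : ℝ) {τ : ℝ} (hτ : τ ∈ Set.Icc 0 β) :
    HasSum (fun n : ℤ => (1 / (β : ℂ)) * (1 / (I * (π * (2 * (n : ℝ) - 1) / β : ℝ)) -
        1 / (I * (π * (2 * (n : ℝ) - 1) / β : ℝ) + ξ)) * cexp (2 * π * I * n * τ / β))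
      (cexp (I * π * τ / β) * (1 / 2 - (1 + Real.exp (-(β * ξ)))⁻¹ * Real.exp (-(ξ * τ)))) := by
  haveI : Fact (0 < β) := ⟨hβ⟩
  set A : ℝ := (1 + Real.exp (-(β * ξ)))⁻¹ with hA
  set G₀ : ℝ → ℂ := fun t => cexp (I * π * t / β) * (1 / 2 - (A : ℝ) * Real.exp (-(ξ * t))) with hG₀
  have hG₀c : Continuous G₀ := by
    rw [hG₀]
    fun_prop
  have hAe : (A : ℂ) * Real.exp (-(ξ * β)) = 1 - A := by
    have h1 : (A : ℝ) * (1 + Real.exp (-(β * ξ))) = 1 := by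
      rw [hA, inv_mul_cancel₀]; positivity
    have h2 : (A : ℝ) * Real.exp (-(ξ * β)) = 1 - A := by
      rw [show ξ * β = β * ξ by ring]; linear_combination h1
    exact_mod_cast h2
  have hper : G₀ 0 = G₀ β := by
    have hβ0 : (β : ℂ) ≠ 0 := by exact_mod_cast hβ.ne'
    have eβ : cexp (I * π * (β : ℂ) / β) = -1 := by
      rw [show I * π * (β : ℂ) / β = π * I by field_simp, Complex.exp_pi_mul_I]
    simp only [hG₀, Complex.ofReal_zero, mul_zero, zero_div, Complex.exp_zero, one_mul, neg_zero,
      Real.exp_zero, Complex.ofReal_one, mul_one, eβ]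
    linear_combination (-1 : ℂ) * hAe
  let F : C(AddCircle β, ℂ) := ⟨AddCircle.liftIco β 0 G₀, AddCircle.liftIco_zero_continuous hper hG₀c.continuousOn⟩
  have hcoef : ∀ n : ℤ, fourierCoeff F n = (1 / (β : ℂ)) * (1 / (I * (π * (2 * (n : ℝ) - 1) / β : ℝ)) -
      1 / (I * (π * (2 * (n : ℝ) - 1) / β : ℝ) + ξ)) := by
    intro n
    rw [← integral_remainderFn_fourier hβ ξ n, ContinuousMap.coe_mk, fourierCoeff_liftIco_eq,
      fourierCoeffOn_eq_integral]
    simp only [zero_add, sub_zero]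
    rw [Complex.real_smul]
    push_cast
    congr 1
    refine intervalIntegral.integral_congr fun x _ => ?_
    rw [fourier_coe_apply, smul_eq_mul, hG₀, hA]
    push_cast
    ring_nf
  have hsum' : Summable (fourierCoeff F) := (summable_remainderCoeff hβ ξ).congr fun n => (hcoef n).symm
  have step := has_pointwise_sum_fourier_series_of_summable hsum' ((τ : ℝ) : AddCircle β)
  have hF : F ((τ : ℝ) : AddCircle β) = G₀ τ := by
    change AddCircle.liftIco β 0 G₀ _ = _
    rcases eq_or_lt_of_le hτ.2 with h | h
    · -- `τ = β ≡ 0`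
      have h0 : ((β : ℝ) : AddCircle β) = ((0 : ℝ) : AddCircle β) := by
        rw [AddCircle.coe_period, QuotientAddGroup.mk_zero]
      rw [h, h0, AddCircle.liftIco_coe_apply (by simp [hβ]), hper]
    · rw [AddCircle.liftIco_coe_apply (by simp [hτ.1, h])]
  rw [hF] at step
  convert step using 1
  ext n
  rw [hcoef, smul_eq_mul, fourier_coe_apply]

end Fourier

/-! ### The truncated remainder `R_M(τ)` and its limit -/

/-- One term of the remainder after the re-indexing `ω = -ν`:
`e^{iντ}(1/(-iν − ξ) − 1/(-iν)) = e^{iντ}(1/(iν) − 1/(iν + ξ))`. [folklore] -/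
theorem remainderTerm_neg (ν ξ τ : ℝ) :
    cexp (-(I * (-ν : ℝ) * τ)) * (1 / (I * (-ν : ℝ) - ξ) - 1 / (I * (-ν : ℝ))) =
      cexp (I * ν * τ) * (1 / (I * ν) - 1 / (I * ν + ξ)) := by
  push_cast
  rw [show -(I * -(ν : ℂ) * τ) = I * ν * τ by ring]
  congr 1
  rw [show I * -(ν : ℂ) - ξ = -(I * ν + ξ) by ring, show I * -(ν : ℂ) = -(I * ν) by ring,
    one_div_neg_eq_neg_one_div, one_div_neg_eq_neg_one_div]
  ring

/-- **The truncated remainder is a symmetric Fourier partial sum**: with `d_n` the remainder coefficients,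
`(1/β) Σᵢ e^{-iωᵢτ}(1/(iωᵢ − ξ) − 1/(iωᵢ)) = e^{-iπτ/β} Σ_{-M < n ≤ M} d_n e^{2πinτ/β}`. [folklore] -/
theorem truncatedRemainder_eq_partialSum {β : ℝ} (hβ : 0 < β) (ξ τ : ℝ) (M : ℕ) :
    (1 / (β : ℂ)) * ∑ i : MatsubaraIdx M, cexp (-(I * matsubaraFreq β M i * τ)) *
        (1 / (I * matsubaraFreq β M i - ξ) - 1 / (I * matsubaraFreq β M i)) =
      cexp (-(I * π * τ / β)) * ∑ n ∈ Finset.Ioc (-(M : ℤ)) M,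
        (1 / (β : ℂ)) * (1 / (I * (π * (2 * (n : ℝ) - 1) / β : ℝ)) -
          1 / (I * (π * (2 * (n : ℝ) - 1) / β : ℝ) + ξ)) * cexp (2 * π * I * n * τ / β) := by
  have hβ0 : (β : ℂ) ≠ 0 := by exact_mod_cast hβ.ne'
  rw [sum_matsubaraIdx_freq_eq_sum_Ioc β M (fun ω : ℝ => cexp (-(I * ω * τ)) *
    (1 / (I * ω - ξ) - 1 / (I * ω))), Finset.mul_sum, Finset.mul_sum]
  refine Finset.sum_congr rfl fun n _ => ?_
  have hων : π * (1 - 2 * (n : ℝ)) / β = -(π * (2 * (n : ℝ) - 1) / β) := by ring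
  simp only [hων]
  rw [remainderTerm_neg]
  have hexp : cexp (I * (π * (2 * (n : ℝ) - 1) / β : ℝ) * τ) =
      cexp (-(I * π * τ / β)) * cexp (2 * π * I * n * τ / β) := by
    rw [← Complex.exp_add]
    congr 1
    push_cast
    field_simp
    ring
  rw [hexp]
  ring

/-- `Finset.Ioc (-M) M` exhausts `ℤ` monotonically as `M → ∞`. [folklore] -/
theorem tendsto_Ioc_neg_atTop : Tendsto (fun M : ℕ => Finset.Ioc (-(M : ℤ)) M) atTop atTop := by
  refine tendsto_atTop_finset_of_monotone (fun M N hMN => ?_) fun n => ?_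
  · intro x hx
    simp only [Finset.mem_Ioc] at hx ⊢
    have : (M : ℤ) ≤ N := by exact_mod_cast hMN
    constructor <;> linarith
  · refine ⟨n.natAbs + 1, ?_⟩
    show n ∈ Finset.Ioc (-((n.natAbs + 1 : ℕ) : ℤ)) ((n.natAbs + 1 : ℕ) : ℤ)
    simp only [Finset.mem_Ioc]
    omega

/-- **Limit of the truncated remainder on `[0, β]`**:
`(1/β) Σᵢ e^{-iωᵢτ}(1/(iωᵢ − ξ) − 1/(iωᵢ)) → ½ − e^{-ξτ}/(1 + e^{-βξ})` as `M → ∞` (`β > 0`, `τ ∈ [0, β]`),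
i.e. `½ − (1 − n_F(ξ))e^{-ξτ}`: the time-ordered propagator minus its square-wave part `-½ sgn τ`.
[cite: BenfattoGiulianiMastropietro2006, §2.1 (2.3)-(2.4)] -/
theorem tendsto_truncatedRemainder_of_mem_Icc {β : ℝ} (hβ : 0 < β) (ξ : ℝ) {τ : ℝ} (hτ : τ ∈ Set.Icc 0 β) :
    Tendsto (fun M : ℕ => (1 / (β : ℂ)) * ∑ i : MatsubaraIdx M, cexp (-(I * matsubaraFreq β M i * τ)) *
        (1 / (I * matsubaraFreq β M i - ξ) - 1 / (I * matsubaraFreq β M i)))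
      atTop (𝓝 (((1 / 2 - (1 + Real.exp (-(β * ξ)))⁻¹ * Real.exp (-(ξ * τ)) : ℝ) : ℂ))) := by
  have hβ0 : (β : ℂ) ≠ 0 := by exact_mod_cast hβ.ne'
  have hsum := hasSum_remainderFn_fourier hβ ξ hτ
  have hpart := (hsum.comp tendsto_Ioc_neg_atTop).const_mul (cexp (-(I * π * τ / β)))
  have hval : cexp (-(I * π * τ / β)) * (cexp (I * π * τ / β) *
      (1 / 2 - (1 + Real.exp (-(β * ξ)))⁻¹ * Real.exp (-(ξ * τ)))) =
      ((1 / 2 - (1 + Real.exp (-(β * ξ)))⁻¹ * Real.exp (-(ξ * τ)) : ℝ) : ℂ) := by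
    rw [← mul_assoc, ← Complex.exp_add, neg_add_cancel, Complex.exp_zero, one_mul]
    push_cast
    ring
  rw [hval] at hpart
  refine hpart.congr fun M => ?_
  rw [Function.comp_apply, truncatedRemainder_eq_partialSum hβ ξ τ M]

/-- `e^{-iωᵢβ} = -1` for every truncated Matsubara frequency (`β ≠ 0`): each term of a truncated frequency
sum is `β`-antiperiodic in `τ`. [folklore] -/
theorem exp_neg_I_matsubaraFreq_mul {β : ℝ} (hβ : β ≠ 0) (M : ℕ) (i : MatsubaraIdx M) :
    cexp (-(I * matsubaraFreq β M i * β)) = -1 := by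
  have h := Literature.Analysis.Fourier.exp_pi_mul_I_mul_odd (matsubaraInt M i)
  have hβ0 : (β : ℂ) ≠ 0 := by exact_mod_cast hβ
  have hω : I * (matsubaraFreq β M i : ℂ) * β = π * I * (2 * (matsubaraInt M i : ℂ) + 1) := by
    simp only [matsubaraFreq]
    push_cast
    field_simp
  rw [hω, Complex.exp_neg, h, inv_neg, inv_one]

/-- Antiperiodicity of the truncated remainder: `R_M(τ + β) = -R_M(τ)`. [folklore] -/
theorem truncatedRemainder_add_period {β : ℝ} (hβ : β ≠ 0) (ξ τ : ℝ) (M : ℕ) :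
    (1 / (β : ℂ)) * ∑ i : MatsubaraIdx M, cexp (-(I * matsubaraFreq β M i * (τ + β : ℝ))) *
        (1 / (I * matsubaraFreq β M i - ξ) - 1 / (I * matsubaraFreq β M i)) =
      -((1 / (β : ℂ)) * ∑ i : MatsubaraIdx M, cexp (-(I * matsubaraFreq β M i * τ)) *
        (1 / (I * matsubaraFreq β M i - ξ) - 1 / (I * matsubaraFreq β M i))) := by
  rw [← mul_neg, ← Finset.sum_neg_distrib]
  congr 1
  refine Finset.sum_congr rfl fun i _ => ?_
  have h := exp_neg_I_matsubaraFreq_mul hβ M i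
  have e : cexp (-(I * (matsubaraFreq β M i : ℂ) * ((τ + β : ℝ) : ℂ))) =
      -cexp (-(I * matsubaraFreq β M i * τ)) := by
    have : -(I * (matsubaraFreq β M i : ℂ) * ((τ + β : ℝ) : ℂ)) =
        -(I * matsubaraFreq β M i * τ) + -(I * matsubaraFreq β M i * β) := by push_cast; ring
    rw [this, Complex.exp_add, h, mul_neg_one]
  rw [e, neg_mul]

/-- **Limit of the truncated remainder on `[-β, 0]`**:
`(1/β) Σᵢ e^{-iωᵢτ}(1/(iωᵢ − ξ) − 1/(iωᵢ)) → e^{-ξτ}/(1 + e^{βξ}) − ½` as `M → ∞` (`β > 0`, `τ ∈ [-β, 0]`),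
i.e. `n_F(ξ) e^{-ξτ} − ½`. [cite: BenfattoGiulianiMastropietro2006, §2.1 (2.3)-(2.4)] -/
theorem tendsto_truncatedRemainder_of_mem_Icc_neg {β : ℝ} (hβ : 0 < β) (ξ : ℝ) {τ : ℝ}
    (hτ : τ ∈ Set.Icc (-β) 0) :
    Tendsto (fun M : ℕ => (1 / (β : ℂ)) * ∑ i : MatsubaraIdx M, cexp (-(I * matsubaraFreq β M i * τ)) *
        (1 / (I * matsubaraFreq β M i - ξ) - 1 / (I * matsubaraFreq β M i)))
      atTop (𝓝 ((((1 + Real.exp (β * ξ))⁻¹ * Real.exp (-(ξ * τ)) - 1 / 2 : ℝ) : ℂ))) := by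
  have hτ' : τ + β ∈ Set.Icc 0 β := ⟨by linarith [hτ.1], by linarith [hτ.2]⟩
  have h := (tendsto_truncatedRemainder_of_mem_Icc hβ ξ hτ').neg
  have hval : -(((1 / 2 - (1 + Real.exp (-(β * ξ)))⁻¹ * Real.exp (-(ξ * (τ + β))) : ℝ) : ℂ)) =
      (((1 + Real.exp (β * ξ))⁻¹ * Real.exp (-(ξ * τ)) - 1 / 2 : ℝ) : ℂ) := by
    have key : (1 + Real.exp (-(β * ξ)))⁻¹ * Real.exp (-(ξ * (τ + β))) =
        (1 + Real.exp (β * ξ))⁻¹ * Real.exp (-(ξ * τ)) := by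
      rw [show -(ξ * (τ + β)) = -(ξ * τ) + -(β * ξ) by ring, Real.exp_add]
      have h1 : (0 : ℝ) < 1 + Real.exp (-(β * ξ)) := by positivity
      have h2 : (0 : ℝ) < 1 + Real.exp (β * ξ) := by positivity
      have h3 : Real.exp (β * ξ) * Real.exp (-(β * ξ)) = 1 := by rw [← Real.exp_add, add_neg_cancel, Real.exp_zero]
      field_simp
      nlinarith [h3, Real.exp_pos (-(ξ * τ))]
    rw [← Complex.ofReal_neg]
    congr 1
    rw [key]
    ring
  rw [hval] at h
  refine h.congr fun M => ?_
  rw [truncatedRemainder_add_period hβ.ne' ξ τ M, neg_neg]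

/-! ### The uniform bound -/

/-- `Σ_{n<M} 1/(2n+1)² ≤ π²/6` (crudely, by `1/(2n+1)² ≤ 1/(n+1)²` and `ζ(2) = π²/6`). [folklore] -/
theorem sum_range_one_div_odd_sq_le (M : ℕ) :
    ∑ n ∈ range M, 1 / ((2 * (n : ℝ) + 1) ^ 2) ≤ π ^ 2 / 6 := by
  have hz : HasSum (fun n : ℕ => 1 / ((n : ℝ) + 1) ^ 2) (π ^ 2 / 6) := by
    have h := (hasSum_nat_add_iff' 1).mpr hasSum_zeta_two
    simp only [Finset.range_one, Finset.sum_singleton, Nat.cast_zero, ne_eq, OfNat.ofNat_ne_zero,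
      not_false_eq_true, zero_pow, div_zero, sub_zero] at h
    exact_mod_cast h
  calc ∑ n ∈ range M, 1 / ((2 * (n : ℝ) + 1) ^ 2) ≤ ∑ n ∈ range M, 1 / ((n : ℝ) + 1) ^ 2 := by
        refine Finset.sum_le_sum fun n _ => ?_
        apply one_div_le_one_div_of_le (by positivity)
        have hn : (0 : ℝ) ≤ n := n.cast_nonneg
        nlinarith
    _ ≤ π ^ 2 / 6 := sum_le_hasSum (range M) (fun n _ => by positivity) hz

/-- The sum of `1/ωᵢ²` over the truncated frequency set: `Σᵢ 1/ωᵢ² ≤ β²/3`. [folklore] -/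
theorem sum_matsubaraIdx_one_div_sq_le {β : ℝ} (hβ : 0 < β) (M : ℕ) :
    ∑ i : MatsubaraIdx M, 1 / (matsubaraFreq β M i) ^ 2 ≤ β ^ 2 / 3 := by
  rw [sum_matsubaraIdx_freq_eq_sum_range β M (fun ω => 1 / ω ^ 2)]
  simp only [neg_sq]
  have h : ∑ n ∈ range M, 1 / ((2 * (n : ℝ) + 1) * π / β) ^ 2 =
      (β ^ 2 / π ^ 2) * ∑ n ∈ range M, 1 / ((2 * (n : ℝ) + 1) ^ 2) := by
    rw [Finset.mul_sum]
    refine Finset.sum_congr rfl fun n _ => ?_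
    have : (2 * (n : ℝ) + 1) ≠ 0 := by positivity
    field_simp
  rw [h, ← two_mul]
  have hs := sum_range_one_div_odd_sq_le M
  have hπ : (0 : ℝ) < π ^ 2 := by positivity
  calc 2 * (β ^ 2 / π ^ 2 * ∑ n ∈ range M, 1 / (2 * (n : ℝ) + 1) ^ 2)
      ≤ 2 * (β ^ 2 / π ^ 2 * (π ^ 2 / 6)) := by gcongr
    _ = β ^ 2 / 3 := by field_simp; ring

/-- **Uniform bound on the truncated remainder**: `‖(1/β) Σᵢ e^{-iωᵢτ}(1/(iωᵢ − ξ) − 1/(iωᵢ))‖ ≤ β|ξ|/3`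
for every `M` and every real `τ` (`β > 0`; from `|1/(iω − ξ) − 1/(iω)| ≤ |ξ|/ω²` and `Σᵢ 1/ωᵢ² ≤ β²/3`).
[folklore] -/
theorem norm_truncatedRemainder_le {β : ℝ} (hβ : 0 < β) (ξ τ : ℝ) (M : ℕ) :
    ‖(1 / (β : ℂ)) * ∑ i : MatsubaraIdx M, cexp (-(I * matsubaraFreq β M i * τ)) *
        (1 / (I * matsubaraFreq β M i - ξ) - 1 / (I * matsubaraFreq β M i))‖ ≤ β * |ξ| / 3 := by
  have hterm : ∀ i : MatsubaraIdx M, ‖cexp (-(I * matsubaraFreq β M i * τ)) *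
      (1 / (I * matsubaraFreq β M i - ξ) - 1 / (I * matsubaraFreq β M i))‖ ≤
      |ξ| / (matsubaraFreq β M i) ^ 2 := by
    intro i
    have hω := matsubaraFreq_ne_zero hβ.ne' i
    rw [norm_mul, show -(I * (matsubaraFreq β M i : ℂ) * τ) = ((-(matsubaraFreq β M i * τ) : ℝ) : ℂ) * I by
      push_cast; ring, Complex.norm_exp_ofReal_mul_I, one_mul]
    have h := norm_inv_I_mul_sub_inv_le hω (-ξ)
    rw [abs_neg, Complex.ofReal_neg, ← sub_eq_add_neg] at h
    rwa [← norm_neg, neg_sub]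
  calc ‖(1 / (β : ℂ)) * ∑ i : MatsubaraIdx M, cexp (-(I * matsubaraFreq β M i * τ)) *
        (1 / (I * matsubaraFreq β M i - ξ) - 1 / (I * matsubaraFreq β M i))‖
      ≤ (1 / β) * ∑ i : MatsubaraIdx M, |ξ| / (matsubaraFreq β M i) ^ 2 := by
        rw [norm_mul, norm_div, norm_one, Complex.norm_real, Real.norm_of_nonneg hβ.le]
        exact mul_le_mul_of_nonneg_left ((norm_sum_le _ _).trans (Finset.sum_le_sum fun i _ => hterm i))
          (by positivity)
    _ = (|ξ| / β) * ∑ i : MatsubaraIdx M, 1 / (matsubaraFreq β M i) ^ 2 := by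
        rw [Finset.mul_sum, Finset.mul_sum]
        refine Finset.sum_congr rfl fun i _ => ?_
        ring
    _ ≤ (|ξ| / β) * (β ^ 2 / 3) :=
        mul_le_mul_of_nonneg_left (sum_matsubaraIdx_one_div_sq_le hβ M) (by positivity)
    _ = β * |ξ| / 3 := by field_simp

end Literature.MathematicalPhysics.QuantumLattice
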